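import Literature.Probability.Percolation.HierarchicalRenormalisationStep
import Literature.Probability.LatticeModels.ProdBernoulliBK
import HarnessLib

/-!
# Hierarchical long-range percolation: the recursion for the two-point function (Hutchcroft 2022, Lemma 2.10)

Topic `Literature/Probability/Percolation`. Sequel of `HierarchicalRenormalisationStep.lean`, toward
the named fact `Hutchcroft2022_twoPoint_volumeTail` (§2.4 of the paper):

* `Walk.exists_split_at_bad_edge`, `exists_walk_witness`, `isFinitary_reachable_etaCfg` — an open
  path of `η_{B_{m+1}}` not open in `η_{B_m}` uses an edge of `ω_{B_{m+1}}`, and the three events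
  "that edge is open", "`x ↔ a`", "`y ↔ b`" occur disjointly (finite witnesses on the labelled space);
* `hierLaw_real_reachable_succ_diff_le` (union bound + BK) and
  **`hierLaw_real_reachable_le_add_sum`** — Lemma 2.10 in finite form:
  `P(x ↔ y in η_{B_M}) ≤ P(x ↔ y in η_{B_n}) + cβ Σ_{m=n+1}^{M} L^{-(d+α)m} Σ_{a,b∈B_m} P(x ↔ a in η_{B_m}) P(y ↔ b in η_{B_m})`;
* `reachable_etaCfg_univ_iff`, `tendsto_hierLaw_real_reachable_block` — `ω = ⋃_M η_{B_M}`, so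
  `P_β(x ↔ y) = lim_M P_{β,σ}(x ↔ y in η_{B_M})`;
* `Tblock` (the sums `𝐓_k(B_n)`) and **`sum_real_reachable_block_le`** — (2.16) in finite form.

## References

* [Hutchcroft2022] T. Hutchcroft, J. Math. Phys. 63 (2022), arXiv:2202.07634, Lemma 2.10 and its
  proof, (2.16) (p. 12).
* [GrimmettPercolation1999] G. Grimmett, *Percolation*, 2nd ed., Thm. 2.12 (BK), §2.3.
-/

noncomputable section

namespace Literature.Probability.Percolation

open Finset MeasureTheory Literature.Probability.LatticeModels
open scoped Literature.Probability.Percolation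

variable {d : ℕ}

/-! ### Splitting walks and finite witnesses -/

section WalkSplit

variable {V : Type*}

/-- **Splitting a walk at a marked edge**: if some edge of the walk `p : u ⟶ v` is `bad`, there are
an oriented bad edge `(a,b)` of `p` and walks `u ⟶ a`, `b ⟶ v` along `p`; when the edges of `p`
are pairwise distinct (a path) the two pieces avoid `{a,b}` and each other ("every path connecting
`x` and `y` in `η_m` must include an edge of `ω_{B_m}` … the events … all occur disjointly").
[cite: Hutchcroft2022, proof of Lemma 2.10] -/
theorem Walk.exists_split_at_bad_edge {G : SimpleGraph V} {u v : V} (p : G.Walk u v)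
    (bad : Sym2 V → Prop) (h : ∃ e ∈ p.edges, bad e) :
    ∃ (a b : V) (q₁ : G.Walk u a) (q₂ : G.Walk b v), G.Adj a b ∧ bad s(a, b) ∧ s(a, b) ∈ p.edges ∧
      q₁.edges ⊆ p.edges ∧ q₂.edges ⊆ p.edges ∧
      (p.edges.Nodup → s(a, b) ∉ q₁.edges ∧ s(a, b) ∉ q₂.edges ∧ List.Disjoint q₁.edges q₂.edges) := by
  induction p with
  | nil => simp at h
  | @cons u w v hadj p ih =>
    by_cases hb : bad s(u, w)
    · refine ⟨u, w, SimpleGraph.Walk.nil, p, hadj, hb, by simp, by simp, fun e he => by simp [he], ?_⟩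
      intro hnd
      rw [SimpleGraph.Walk.edges_cons, List.nodup_cons] at hnd
      exact ⟨by simp, hnd.1, by simp⟩
    · have h' : ∃ e ∈ p.edges, bad e := by
        obtain ⟨e, he, hbe⟩ := h
        rw [SimpleGraph.Walk.edges_cons, List.mem_cons] at he
        rcases he with rfl | he
        · exact absurd hbe hb
        · exact ⟨e, he, hbe⟩
      obtain ⟨a, b, q₁, q₂, hab, hbad, hmem, hq₁, hq₂, hdis⟩ := ih h'
      refine ⟨a, b, SimpleGraph.Walk.cons hadj q₁, q₂, hab, hbad, ?_, ?_, ?_, ?_⟩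
      · rw [SimpleGraph.Walk.edges_cons]; exact List.mem_cons_of_mem _ hmem
      · rw [SimpleGraph.Walk.edges_cons, SimpleGraph.Walk.edges_cons]
        exact List.cons_subset_cons _ hq₁
      · rw [SimpleGraph.Walk.edges_cons]; exact fun e he => List.mem_cons_of_mem _ (hq₂ he)
      · intro hnd
        rw [SimpleGraph.Walk.edges_cons, List.nodup_cons] at hnd
        obtain ⟨h1, h2, h3⟩ := hdis hnd.2
        have hne : s(a, b) ≠ s(u, w) := fun heq => hnd.1 (heq ▸ hmem)
        refine ⟨?_, h2, ?_⟩
        · rw [SimpleGraph.Walk.edges_cons, List.mem_cons]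
          push Not
          exact ⟨hne, h1⟩
        · rw [SimpleGraph.Walk.edges_cons]
          refine List.disjoint_cons_left.2 ⟨fun hmem' => hnd.1 (hq₂ hmem'), h3⟩

end WalkSplit

section Witnesses

open Classical in
/-- The witnessing coordinate of an open pair of `η_A`: `(e,0)` if the `R`-copy is open, else `(e,1)`.
[folklore] -/
def etaPick (ξ : Set (Sym2 (Site d) × Fin 2)) (e : Sym2 (Site d)) : Sym2 (Site d) × Fin 2 :=
  if (e, (0 : Fin 2)) ∈ ξ then (e, 0) else (e, 1)

/-- The first component of the witnessing coordinate. [folklore] -/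
@[simp] theorem etaPick_fst (ξ : Set (Sym2 (Site d) × Fin 2)) (e : Sym2 (Site d)) : (etaPick ξ e).1 = e := by
  unfold etaPick; split_ifs <;> rfl

/-- The witnessing coordinate of an open pair is open. [folklore] -/
theorem etaPick_mem {A : Set (Sym2 (Site d))} {ξ : Set (Sym2 (Site d) × Fin 2)} {e : Sym2 (Site d)}
    (he : e ∈ etaCfg A ξ) : etaPick ξ e ∈ ξ := by
  unfold etaPick
  split_ifs with h
  · exact h
  · simp only [etaCfg, Set.mem_setOf_eq] at he
    exact (he.resolve_left h).1

/-- A configuration containing the witnessing coordinate of an open pair of `η_A(ξ)` has that pair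
open in its own `η_A`. [folklore] -/
theorem mem_etaCfg_of_etaPick_mem {A : Set (Sym2 (Site d))} {ξ : Set (Sym2 (Site d) × Fin 2)}
    {e : Sym2 (Site d)} (he : e ∈ etaCfg A ξ) {K : Set (Sym2 (Site d) × Fin 2)} (hK : etaPick ξ e ∈ K) :
    e ∈ etaCfg A K := by
  unfold etaPick at hK
  simp only [etaCfg, Set.mem_setOf_eq] at he ⊢
  split_ifs at hK with h
  · exact Or.inl hK
  · exact Or.inr ⟨hK, (he.resolve_left h).2⟩

/-- **Finite witnesses for connections in `η_A`**: an open walk `u ⟶ v` of `η_A(ξ)` yields a finite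
set `K ⊆ ξ` of coordinates, one per edge of the walk, with `u ⟶ v` open in `η_A(K)`.
[cite: Hutchcroft2022, proof of Lemma 2.10] -/
theorem exists_walk_witness (A : Set (Sym2 (Site d))) (ξ : Set (Sym2 (Site d) × Fin 2)) {u v : Site d}
    (w : (openGraph (etaCfg A ξ)).Walk u v) :
    ∃ K : Finset (Sym2 (Site d) × Fin 2), (↑K : Set _) ⊆ ξ ∧ (openGraph (etaCfg A ↑K)).Reachable u v ∧
      (∀ k ∈ K, k.1 ∈ w.edges) ∧ ∀ e ∈ w.edges, etaPick ξ e ∈ K := by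
  classical
  refine ⟨w.edges.toFinset.image (etaPick ξ), ?_, ?_, ?_, ?_⟩
  · intro k hk
    obtain ⟨e, he, rfl⟩ := Finset.mem_image.1 hk
    rw [List.mem_toFinset] at he
    have hadj := w.edges_subset_edgeSet he
    induction e using Sym2.ind with
    | h a b =>
      rw [SimpleGraph.mem_edgeSet, openGraph_adj] at hadj
      exact etaPick_mem hadj.1
  · refine ⟨w.transfer (openGraph (etaCfg A ↑(w.edges.toFinset.image (etaPick ξ)))) fun e he => ?_⟩
    have hadj := w.edges_subset_edgeSet he
    induction e using Sym2.ind with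
    | h a b =>
      rw [SimpleGraph.mem_edgeSet, openGraph_adj] at hadj ⊢
      refine ⟨mem_etaCfg_of_etaPick_mem hadj.1 ?_, hadj.2⟩
      exact Finset.mem_coe.2 (Finset.mem_image.2 ⟨_, List.mem_toFinset.2 he, rfl⟩)
  · intro k hk
    obtain ⟨e, he, rfl⟩ := Finset.mem_image.1 hk
    rw [etaPick_fst]; exact List.mem_toFinset.1 he
  · intro e he
    exact Finset.mem_image.2 ⟨e, List.mem_toFinset.2 he, rfl⟩

/-- **Connections in `η_A` are finitary increasing events** of the labelled configuration. [folklore] -/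
theorem isFinitary_reachable_etaCfg (A : Set (Sym2 (Site d))) (u v : Site d) :
    IsFinitary {ξ : Set (Sym2 (Site d) × Fin 2) | (openGraph (etaCfg A ξ)).Reachable u v} := by
  intro ξ hξ
  obtain ⟨K, hK, hreach, -, -⟩ := exists_walk_witness A ξ hξ.some
  exact ⟨K, hK, hreach⟩

/-- Connections in `η_A` are increasing. [folklore] -/
theorem isUpperSet_reachable_etaCfg (A : Set (Sym2 (Site d))) (u v : Site d) :
    IsUpperSet {ξ : Set (Sym2 (Site d) × Fin 2) | (openGraph (etaCfg A ξ)).Reachable u v} := by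
  intro ξ ξ' hle hξ
  have hmono : etaCfg A ξ ⊆ etaCfg A ξ' := by
    intro e he
    simp only [etaCfg, Set.mem_setOf_eq] at he ⊢
    exact he.imp (fun h => hle h) fun h => ⟨hle h.1, h.2⟩
  exact hξ.mono (openGraph_mono hmono)

/-- Connections in `η_A` are measurable. [folklore] -/
theorem measurableSet_reachable_etaCfg (A : Set (Sym2 (Site d))) (u v : Site d) :
    MeasurableSet {ξ : Set (Sym2 (Site d) × Fin 2) | (openGraph (etaCfg A ξ)).Reachable u v} :=
  (measurable_etaCfg A) (measurableSet_openConn_holds u v)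

end Witnesses

section Lemma210

open MeasureTheory

variable {L : ℕ} (hL : 2 ≤ L) (hd : 1 ≤ d) {o : ℕ → Site d} (ho : IsHierOffset L o)
  {J : Sym2 (Site d) → ℝ} {c α β : ℝ}

include hL ho in
/-- The endpoints of a pair of `B_k(z)` lie in `B_k(z)`. [folklore] -/
theorem mem_block_of_mk_mem_blockEdges {k : ℕ} {z a b : Site d}
    (h : s(a, b) ∈ blockEdges L o k z) : a ∈ block L o k z ∧ b ∈ block L o k z := by
  have hL1 : 1 ≤ L := le_trans (by norm_num) hL
  obtain ⟨hprop, hblk, -⟩ := h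
  rw [edgeBlock_mk hL ho hprop] at hblk
  obtain ⟨-, hcommon⟩ := (isProperEdge_mk (L := L) (o := o)).1 hprop
  have hc : HasCommonBlock L o a b := hcommon.elim id fun h' => h'.symm o hL1
  rw [← hblk]
  exact ⟨mem_block_self hL1 o _ a, mem_block_hLevel o hc⟩

include hL ho in
/-- **`P((e,1) open) ≤ cβL^{-(d+α)k}` for a pair `e` of a `k`-block** (`1 - e^{-t} ≤ t`).
[cite: Hutchcroft2022, proof of Lemma 2.10 ("any two vertices of B_m are connected by an edge of ω_{B_m} with probability at most cβL^{-(d+α)m}")] -/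
theorem hierLaw_real_mem_one_le (hc : 0 ≤ c) (hβ : 0 ≤ β) {m : ℕ} {z : Site d} {e : Sym2 (Site d)}
    (he : e ∈ blockEdges L o (m + 1) z) :
    (hierLaw J L o c α β).real {ξ | (e, (1 : Fin 2)) ∈ ξ} ≤ β * (c * ((L : ℝ) ^ (m + 1)) ^ (-((d : ℝ) + α))) := by
  rw [hierLaw, prodBernoulli_real_setOf_mem, coe_hierParam_one_of_blockEdges hL ho hc hβ he]
  have := Real.add_one_le_exp (-(β * (c * ((L : ℝ) ^ (m + 1)) ^ (-((d : ℝ) + α)))))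
  linarith

include hL hd ho in
/-- **One level of the recursion (Lemma 2.10)**: for `B_m ⊂ B_{m+1}` the blocks of `z`,
`P(x ↔ y in η_{B_{m+1}} but not in η_{B_m}) ≤ cβL^{-(d+α)(m+1)} Σ_{a,b ∈ B_{m+1}} P(x ↔ a in η_{B_{m+1}}) P(y ↔ b in η_{B_{m+1}})`
(a path joining `x, y` in `η_{m+1}` but not in `η_m` uses an edge `{a,b}` of `ω_{B_{m+1}}`;
the events `{a,b} open in ω_{B_{m+1}}`, `x ↔ a`, `y ↔ b` occur disjointly; union bound and BK).
[cite: Hutchcroft2022, Lemma 2.10 and its proof (p. 12)] -/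
theorem hierLaw_real_reachable_succ_diff_le (hc : 0 ≤ c) (hβ : 0 ≤ β) (z : Site d) (m : ℕ) (x y : Site d) :
    (hierLaw J L o c α β).real
        ({ξ | (openGraph (etaCfg (aboveFree L o (block L o (m + 1) z)) ξ)).Reachable x y} \
          {ξ | (openGraph (etaCfg (aboveFree L o (block L o m z)) ξ)).Reachable x y}) ≤
      β * (c * ((L : ℝ) ^ (m + 1)) ^ (-((d : ℝ) + α))) *
        ∑ a ∈ block L o (m + 1) z, ∑ b ∈ block L o (m + 1) z,
          (hierLaw J L o c α β).real {ξ | (openGraph (etaCfg (aboveFree L o (block L o (m + 1) z)) ξ)).Reachable x a} *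
          (hierLaw J L o c α β).real {ξ | (openGraph (etaCfg (aboveFree L o (block L o (m + 1) z)) ξ)).Reachable y b} := by
  classical
  set μ := hierLaw J L o c α β with hμ
  set B := block L o (m + 1) z with hB
  set A₁ := aboveFree L o (block L o (m + 1) z) with hA₁
  set A₀ := aboveFree L o (block L o m z) with hA₀
  set h : ℝ := β * (c * ((L : ℝ) ^ (m + 1)) ^ (-((d : ℝ) + α))) with hh
  have hh0 : 0 ≤ h := mul_nonneg hβ (mul_nonneg hc (Real.rpow_nonneg (pow_nonneg (Nat.cast_nonneg _) _) _))
  -- the three events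
  set E₁ : Site d → Site d → Set (Set (Sym2 (Site d) × Fin 2)) := fun a b => {ξ | (s(a, b), (1 : Fin 2)) ∈ ξ} with hE₁
  set E₂ : Site d → Set (Set (Sym2 (Site d) × Fin 2)) := fun a => {ξ | (openGraph (etaCfg A₁ ξ)).Reachable x a} with hE₂
  set E₃ : Site d → Set (Set (Sym2 (Site d) × Fin 2)) := fun b => {ξ | (openGraph (etaCfg A₁ ξ)).Reachable y b} with hE₃
  set S := (B ×ˢ B).filter fun ab => s(ab.1, ab.2) ∈ blockEdges L o (m + 1) z with hS
  -- Step 1: the decomposition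
  have hsub : ({ξ | (openGraph (etaCfg A₁ ξ)).Reachable x y} \ {ξ | (openGraph (etaCfg A₀ ξ)).Reachable x y}) ⊆
      ⋃ ab ∈ S, disjointOccurrenceList [E₁ ab.1 ab.2, E₂ ab.1, E₃ ab.2] := by
    intro ξ hξ
    obtain ⟨hreach, hnot⟩ := hξ
    simp only [Set.mem_setOf_eq] at hreach hnot
    -- a path in `η_{m+1}`
    set G := openGraph (etaCfg A₁ ξ) with hG
    obtain ⟨p, hp⟩ : ∃ p : G.Walk x y, p.IsPath := ⟨hreach.some.toPath.val, hreach.some.toPath.property⟩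
    have hsplit : etaCfg A₁ ξ = etaCfg A₀ ξ ∪ omegaLayer (blockEdges L o (m + 1) z) ξ := by
      rw [hA₁, hA₀]; exact etaCfg_aboveFree_succ hL ho hd m z ξ
    -- some edge of `p` is not in `η_m`
    have hbad : ∃ e ∈ p.edges, e ∉ etaCfg A₀ ξ := by
      by_contra hall
      push Not at hall
      apply hnot
      refine ⟨p.transfer (openGraph (etaCfg A₀ ξ)) fun e he => ?_⟩
      have hadj := p.edges_subset_edgeSet he
      induction e using Sym2.ind with
      | h a b =>
        rw [SimpleGraph.mem_edgeSet, openGraph_adj] at hadj ⊢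
        exact ⟨hall _ he, hadj.2⟩
    obtain ⟨a, b, q₁, q₂, hab, hbadab, hmem, hq₁, hq₂, hdis⟩ :=
      Walk.exists_split_at_bad_edge p (fun e => e ∉ etaCfg A₀ ξ) hbad
    obtain ⟨hn₁, hn₂, hn₁₂⟩ := hdis hp.isTrail.edges_nodup
    -- the edge `{a,b}` is an edge of `ω_{B_{m+1}}`
    have hab' := (openGraph_adj _ a b).1 hab
    have hω : (s(a, b), (1 : Fin 2)) ∈ ξ ∧ s(a, b) ∈ blockEdges L o (m + 1) z := by
      have : s(a, b) ∈ omegaLayer (blockEdges L o (m + 1) z) ξ := by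
        have h1 := hab'.1
        rw [hsplit] at h1
        exact h1.resolve_left hbadab
      exact this
    obtain ⟨haB, hbB⟩ := mem_block_of_mk_mem_blockEdges hL ho hω.2
    refine Set.mem_iUnion₂.2 ⟨(a, b), Finset.mem_filter.2 ⟨Finset.mem_product.2 ⟨haB, hbB⟩, hω.2⟩, ?_⟩
    -- witnesses
    obtain ⟨K₁, hK₁ξ, hK₁reach, hK₁edges, -⟩ := exists_walk_witness A₁ ξ q₁
    obtain ⟨K₂, hK₂ξ, hK₂reach, hK₂edges, -⟩ := exists_walk_witness A₁ ξ q₂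
    have key := mem_disjointOccurrenceList_of_pairwise_disjoint
      [(E₁ a b, ({(s(a, b), (1 : Fin 2))} : Set _)), (E₂ a, ↑K₁), (E₃ b, ↑K₂)]
      ?_ ?_ ?_ (ω := ξ) ?_
    · simpa using key
    · intro q hq
      simp only [List.mem_cons, List.not_mem_nil, or_false] at hq
      rcases hq with rfl | rfl | rfl
      · intro ξ₁ ξ₂ hle h1; exact hle h1
      · exact isUpperSet_reachable_etaCfg A₁ x a
      · exact isUpperSet_reachable_etaCfg A₁ y b
    · intro q hq
      simp only [List.mem_cons, List.not_mem_nil, or_false] at hq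
      rcases hq with rfl | rfl | rfl
      · exact Set.mem_singleton _
      · exact hK₁reach
      · exact hK₂reach.symm
    · refine List.pairwise_cons.2 ⟨fun q hq => ?_,
        List.pairwise_cons.2 ⟨fun q hq => ?_, List.pairwise_singleton _ _⟩⟩
      · simp only [List.mem_cons, List.not_mem_nil, or_false] at hq
        rcases hq with rfl | rfl
        · exact Set.disjoint_singleton_left.2 fun hk => hn₁ (hK₁edges _ hk)
        · exact Set.disjoint_singleton_left.2 fun hk => hn₂ (hK₂edges _ hk)
      · simp only [List.mem_singleton] at hq
        subst hq
        exact Set.disjoint_left.2 fun k hk1 hk2 => hn₁₂ (hK₁edges k hk1) (hK₂edges k hk2)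
    · intro q hq
      simp only [List.mem_cons, List.not_mem_nil, or_false] at hq
      rcases hq with rfl | rfl | rfl
      · exact Set.singleton_subset_iff.2 hω.1
      · exact hK₁ξ
      · exact hK₂ξ
  -- Step 2: union bound and BK
  have hfin : ∀ a b, IsFinitary (E₁ a b) := fun a b ξ hξ =>
    ⟨{(s(a, b), (1 : Fin 2))}, by simpa [hE₁] using hξ, by simp [hE₁]⟩
  have hup₁ : ∀ a b, IsUpperSet (E₁ a b) := fun a b ξ₁ ξ₂ hle h1 => hle h1
  calc μ.real ({ξ | (openGraph (etaCfg A₁ ξ)).Reachable x y} \ {ξ | (openGraph (etaCfg A₀ ξ)).Reachable x y})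
      ≤ μ.real (⋃ ab ∈ S, disjointOccurrenceList [E₁ ab.1 ab.2, E₂ ab.1, E₃ ab.2]) :=
        measureReal_mono hsub (measure_ne_top _ _)
    _ ≤ ∑ ab ∈ S, μ.real (disjointOccurrenceList [E₁ ab.1 ab.2, E₂ ab.1, E₃ ab.2]) :=
        measureReal_biUnion_finset_le _ _
    _ ≤ ∑ ab ∈ S, h * (μ.real (E₂ ab.1) * μ.real (E₃ ab.2)) := by
        refine Finset.sum_le_sum fun ab hab => ?_
        obtain ⟨-, hab'⟩ := Finset.mem_filter.1 hab
        have hbk := prodBernoulli_bk_list (hierParam J L o c α β) [E₁ ab.1 ab.2, E₂ ab.1, E₃ ab.2]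
          (by
            intro E hE
            simp only [List.mem_cons, List.not_mem_nil, or_false] at hE
            rcases hE with rfl | rfl | rfl
            · exact hup₁ _ _
            · exact isUpperSet_reachable_etaCfg A₁ x _
            · exact isUpperSet_reachable_etaCfg A₁ y _)
          (by
            intro E hE
            simp only [List.mem_cons, List.not_mem_nil, or_false] at hE
            rcases hE with rfl | rfl | rfl
            · exact hfin _ _
            · exact isFinitary_reachable_etaCfg A₁ x _
            · exact isFinitary_reachable_etaCfg A₁ y _)
        simp only [List.map_cons, List.map_nil, List.prod_cons, List.prod_nil, mul_one] at hbk
        refine hbk.trans ?_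
        have h1 : (prodBernoulli (hierParam J L o c α β)).real (E₁ ab.1 ab.2) ≤ h :=
          hierLaw_real_mem_one_le hL ho hc hβ hab'
        exact mul_le_mul_of_nonneg_right h1 (mul_nonneg measureReal_nonneg measureReal_nonneg)
    _ ≤ ∑ ab ∈ B ×ˢ B, h * (μ.real (E₂ ab.1) * μ.real (E₃ ab.2)) :=
        Finset.sum_le_sum_of_subset_of_nonneg (Finset.filter_subset _ _) fun _ _ _ =>
          mul_nonneg hh0 (mul_nonneg measureReal_nonneg measureReal_nonneg)
    _ = h * ∑ a ∈ B, ∑ b ∈ B, μ.real (E₂ a) * μ.real (E₃ b) := by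
        rw [Finset.mul_sum, Finset.sum_product]
        refine Finset.sum_congr rfl fun a _ => ?_
        rw [Finset.mul_sum]

include hL hd ho in
/-- **Lemma 2.10 (recursion for the two-point function), finite form**: for the blocks
`B_n ⊂ B_{n+1} ⊂ ⋯ ⊂ B_M` of `z`,
`P(x ↔ y in η_{B_M}) ≤ P(x ↔ y in η_{B_n}) + cβ Σ_{m=n+1}^{M} L^{-(d+α)m} Σ_{a,b∈B_m} P(x ↔ a in η_{B_m}) P(y ↔ b in η_{B_m})`
(the printed statement is the limit `M → ∞`, `η_{B_M} ↑ ω`). [cite: Hutchcroft2022, Lemma 2.10] -/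
theorem hierLaw_real_reachable_le_add_sum (hc : 0 ≤ c) (hβ : 0 ≤ β) (z : Site d) {n M : ℕ} (hnM : n ≤ M)
    (x y : Site d) :
    (hierLaw J L o c α β).real {ξ | (openGraph (etaCfg (aboveFree L o (block L o M z)) ξ)).Reachable x y} ≤
      (hierLaw J L o c α β).real {ξ | (openGraph (etaCfg (aboveFree L o (block L o n z)) ξ)).Reachable x y} +
        ∑ m ∈ Finset.Ioc n M, β * (c * ((L : ℝ) ^ m) ^ (-((d : ℝ) + α))) *
          ∑ a ∈ block L o m z, ∑ b ∈ block L o m z,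
            (hierLaw J L o c α β).real {ξ | (openGraph (etaCfg (aboveFree L o (block L o m z)) ξ)).Reachable x a} *
            (hierLaw J L o c α β).real {ξ | (openGraph (etaCfg (aboveFree L o (block L o m z)) ξ)).Reachable y b} := by
  induction M, hnM using Nat.le_induction with
  | base => simp
  | succ M hnM ih =>
    set μ := hierLaw J L o c α β with hμ
    have hunion : {ξ | (openGraph (etaCfg (aboveFree L o (block L o (M + 1) z)) ξ)).Reachable x y} ⊆
        {ξ | (openGraph (etaCfg (aboveFree L o (block L o M z)) ξ)).Reachable x y} ∪
          ({ξ | (openGraph (etaCfg (aboveFree L o (block L o (M + 1) z)) ξ)).Reachable x y} \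
            {ξ | (openGraph (etaCfg (aboveFree L o (block L o M z)) ξ)).Reachable x y}) := by
      intro ξ hξ
      by_cases h : ξ ∈ {ξ | (openGraph (etaCfg (aboveFree L o (block L o M z)) ξ)).Reachable x y}
      · exact Or.inl h
      · exact Or.inr ⟨hξ, h⟩
    have hstep := hierLaw_real_reachable_succ_diff_le hL hd ho hc hβ z M x y (J := J) (α := α)
    rw [Finset.sum_Ioc_succ_top (by omega), ← add_assoc]
    calc μ.real _ ≤ μ.real _ := measureReal_mono hunion (measure_ne_top _ _)
      _ ≤ μ.real _ + μ.real _ := measureReal_union_le _ _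
      _ ≤ _ := add_le_add ih hstep

end Lemma210

section Limit

open MeasureTheory Filter Topology

variable {L : ℕ} (hL : 2 ≤ L) (hd : 1 ≤ d) {o : ℕ → Site d} (ho : IsHierOffset L o)
  {J : Sym2 (Site d) → ℝ} {c α β : ℝ}

include hL hd ho in
/-- `η_{B_M(z)} ⊆ η_{B_{M+1}(z)}`. [cite: Hutchcroft2022, §2.1 (2.4)] -/
theorem etaCfg_aboveFree_block_mono (z : Site d) (ξ : Set (Sym2 (Site d) × Fin 2)) :
    Monotone fun M => etaCfg (aboveFree L o (block L o M z)) ξ := by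
  refine monotone_nat_of_le_succ fun M => ?_
  show etaCfg (aboveFree L o (block L o M z)) ξ ⊆ etaCfg (aboveFree L o (block L o (M + 1) z)) ξ
  rw [etaCfg_aboveFree_succ hL ho hd M z ξ]
  exact Set.subset_union_left

include hL hd in
/-- Blocks are eventually larger than any fixed finite set: `|B_M(z)| ≥ M + 1`. [folklore] -/
theorem succ_le_card_block (M : ℕ) (z : Site d) : M + 1 ≤ (block L o M z).card := by
  rw [card_block o M z, ← pow_mul]
  calc M + 1 ≤ 2 ^ M := Nat.lt_two_pow_self
    _ ≤ L ^ M := Nat.pow_le_pow_left hL M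
    _ ≤ L ^ (M * d) := Nat.pow_le_pow_right (by omega) (Nat.le_mul_of_pos_right M hd)

include hL hd ho in
/-- **`ω = ⋃_M η_{B_M(z)}` on connections**: `x ↔ y` in the full configuration `η_{ℤ^d}(ξ)` iff
`x ↔ y` in `η_{B_M(z)}(ξ)` for some `M` (an open path has finitely many edges, each selected by
`A_{B_M}` once `B_M(z)` is larger than its block). [cite: Hutchcroft2022, proof of Lemma 2.10 ("Since ω = ⋃_{m ≥ n} η_m")] -/
theorem reachable_etaCfg_univ_iff (z x y : Site d) (ξ : Set (Sym2 (Site d) × Fin 2)) :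
    (openGraph (etaCfg Set.univ ξ)).Reachable x y ↔
      ∃ M, (openGraph (etaCfg (aboveFree L o (block L o M z)) ξ)).Reachable x y := by
  classical
  constructor
  · rintro ⟨p⟩
    -- induction on the walk
    suffices h : ∀ (u : Site d) (q : (openGraph (etaCfg Set.univ ξ)).Walk u y),
        ∃ M, (openGraph (etaCfg (aboveFree L o (block L o M z)) ξ)).Reachable u y from h x p
    clear p
    intro u q
    induction q with
    | nil => exact ⟨0, SimpleGraph.Reachable.refl _⟩
    | @cons u w v hadj q ih =>
      obtain ⟨M', hM'⟩ := ih
      set M := max M' (edgeBlock L o s(u, w)).card with hM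
      obtain ⟨he, huw⟩ := (openGraph_adj _ u w).1 hadj
      have hmem : s(u, w) ∈ etaCfg (aboveFree L o (block L o M z)) ξ := by
        simp only [etaCfg, Set.mem_setOf_eq, Set.mem_univ, and_true] at he ⊢
        refine he.imp id fun h1 => ⟨h1, ?_⟩
        -- `B_M(z)` is not a strict subset of the edge block
        intro hss
        have h1 := Finset.card_lt_card hss
        have h2 := succ_le_card_block hL hd M z (o := o)
        have h3 : (edgeBlock L o s(u, w)).card ≤ M := le_max_right _ _
        omega
      refine ⟨M, ?_⟩
      have hadj' : (openGraph (etaCfg (aboveFree L o (block L o M z)) ξ)).Adj u w :=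
        (openGraph_adj _ u w).2 ⟨hmem, huw⟩
      exact hadj'.reachable.trans (hM'.mono (openGraph_mono
        (etaCfg_aboveFree_block_mono hL hd ho z ξ (le_max_left _ _))))
  · rintro ⟨M, hM⟩
    refine hM.mono (openGraph_mono fun e he => ?_)
    simp only [etaCfg, Set.mem_setOf_eq, Set.mem_univ, and_true] at he ⊢
    exact he.imp id fun h => h.1

include hL hd ho in
/-- **`P_β(x ↔ y) = lim_M P_{β,σ}(x ↔ y in η_{B_M(z)})`** (monotone convergence; the law of the
full configuration `η_{ℤ^d}` under `P_{β,σ}` is `P_β`). [cite: Hutchcroft2022, §2.1 (p. 7, "ω … is distributed as long-range percolation … J") and Lemma 2.10] -/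
theorem tendsto_hierLaw_real_reachable_block (hc : 0 ≤ c) (hα : 0 ≤ (d : ℝ) + α) (hJ0 : ∀ e, 0 ≤ J e)
    (hJ : HasPowerLowerBound J c α) (hβ : 0 ≤ β) (z x y : Site d) :
    Tendsto (fun M => (hierLaw J L o c α β).real
        {ξ | (openGraph (etaCfg (aboveFree L o (block L o M z)) ξ)).Reachable x y}) atTop
      (𝓝 ((kernelPercolation J β).real (openConn x y))) := by
  have hL1 : 1 ≤ L := le_trans (by norm_num) hL
  set μ := hierLaw J L o c α β with hμ
  have hfull : (kernelPercolation J β).real (openConn x y) =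
      μ.real {ξ | (openGraph (etaCfg Set.univ ξ)).Reachable x y} := by
    rw [← hierLaw_map_etaCfg_univ hL1 ho hc hα hJ0 hJ hβ, measureReal_def, measureReal_def,
      Measure.map_apply (measurable_etaCfg _) (measurableSet_openConn_holds x y)]
    rfl
  have hunion : {ξ | (openGraph (etaCfg Set.univ ξ)).Reachable x y} =
      ⋃ M, {ξ | (openGraph (etaCfg (aboveFree L o (block L o M z)) ξ)).Reachable x y} := by
    ext ξ
    simp only [Set.mem_setOf_eq, Set.mem_iUnion]
    exact reachable_etaCfg_univ_iff hL hd ho z x y ξ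
  have hmono : Monotone fun M => {ξ : Set (Sym2 (Site d) × Fin 2) |
      (openGraph (etaCfg (aboveFree L o (block L o M z)) ξ)).Reachable x y} := by
    intro M M' hMM' ξ hξ
    exact hξ.mono (openGraph_mono (etaCfg_aboveFree_block_mono hL hd ho z ξ hMM'))
  rw [hfull, hunion]
  have h := tendsto_measure_iUnion_atTop (μ := μ) hmono
  simp only [measureReal_def]
  exact (ENNReal.tendsto_toReal (measure_ne_top _ _)).comp h

end Limit

section Summed

open MeasureTheory

variable {L : ℕ} (hL : 2 ≤ L) (hd : 1 ≤ d) {o : ℕ → Site d} (ho : IsHierOffset L o)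
  {J : Sym2 (Site d) → ℝ} {c α β : ℝ}

/-- **`𝐓`-sums**: `Tblock n m z = Σ_{x ∈ B_n(z)} Σ_{y ∈ B_m(z)} P_{β,σ}(x ↔ y in η_{B_m(z)})`
(the printed `𝐓_k(B_n)` is `Tblock n (n+k) z`; `Tblock n n z = Σ_{x,y∈B_n} P(x ↔ y in η_{B_n})`).
[cite: Hutchcroft2022, §2.4 (p. 12, 𝐓_k(B_n))] -/
def Tblock (J : Sym2 (Site d) → ℝ) (L : ℕ) (o : ℕ → Site d) (c α β : ℝ) (n m : ℕ) (z : Site d) : ℝ :=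
  ∑ x ∈ block L o n z, ∑ y ∈ block L o m z, (etaLaw J L o c α β (block L o m z)).real (openConn x y)

/-- `Tblock ≥ 0`. [folklore] -/
theorem Tblock_nonneg (n m : ℕ) (z : Site d) : 0 ≤ Tblock J L o c α β n m z :=
  Finset.sum_nonneg fun _ _ => Finset.sum_nonneg fun _ _ => measureReal_nonneg

/-- `Tblock n n z = Σ_{x,y ∈ B_n(z)} P(x ↔ y in η_{B_n(z)})` is the restricted susceptibility `sumConn`.
[cite: Hutchcroft2022, §2.4 (p. 12)] -/
theorem Tblock_self (n : ℕ) (z : Site d) : Tblock J L o c α β n n z = sumConn J L o c α β (block L o n z) := rfl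

/-- The `η_B`-connection probability as a `P_{β,σ}`-probability. [folklore] -/
theorem etaLaw_real_openConn_eq (B : Finset (Site d)) (x y : Site d) :
    (etaLaw J L o c α β B).real (openConn x y) =
      (hierLaw J L o c α β).real {ξ | (openGraph (etaCfg (aboveFree L o B) ξ)).Reachable x y} := by
  rw [etaLaw, measureReal_def, measureReal_def,
    Measure.map_apply (measurable_etaCfg _) (measurableSet_openConn_holds x y)]
  rfl


/-- Rearranging a fourfold sum of products into a product of double sums. [folklore] -/
theorem sum_sum_sum_sum_mul {ι κ : Type*} (s : Finset ι) (t : Finset κ) (f g : ι → κ → ℝ) :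
    ∑ x ∈ s, ∑ y ∈ s, ∑ a ∈ t, ∑ b ∈ t, f x a * g y b =
      (∑ x ∈ s, ∑ a ∈ t, f x a) * (∑ y ∈ s, ∑ b ∈ t, g y b) := by
  rw [Finset.sum_mul_sum]
  refine Finset.sum_congr rfl fun x _ => Finset.sum_congr rfl fun y _ => ?_
  rw [Finset.sum_mul_sum]

include hL hd ho in
/-- **(2.16), finite form**: summing Lemma 2.10 over `x, y ∈ B_n`,
`Σ_{x,y∈B_n} P(x ↔ y in η_{B_M}) ≤ 𝐓_0(B_n) + cβ Σ_{m=n+1}^{M} L^{-(d+α)m} 𝐓_{m-n}(B_n)²`.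
[cite: Hutchcroft2022, §2.4 (2.16)] -/
theorem sum_real_reachable_block_le (hc : 0 ≤ c) (hβ : 0 ≤ β) (z : Site d) {n M : ℕ} (hnM : n ≤ M) :
    ∑ x ∈ block L o n z, ∑ y ∈ block L o n z, (hierLaw J L o c α β).real
        {ξ | (openGraph (etaCfg (aboveFree L o (block L o M z)) ξ)).Reachable x y} ≤
      Tblock J L o c α β n n z + ∑ m ∈ Finset.Ioc n M,
        β * (c * ((L : ℝ) ^ m) ^ (-((d : ℝ) + α))) * Tblock J L o c α β n m z ^ 2 := by
  -- pointwise Lemma 2.10, summed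
  have h1 := Finset.sum_le_sum fun x (_ : x ∈ block L o n z) => Finset.sum_le_sum fun y (_ : y ∈ block L o n z) =>
    hierLaw_real_reachable_le_add_sum hL hd ho hc hβ z hnM x y (J := J) (α := α)
  refine h1.trans (le_of_eq ?_)
  simp only [Finset.sum_add_distrib]
  congr 1
  · -- the first term is `𝐓_0(B_n)`
    simp only [Tblock, etaLaw_real_openConn_eq]
  · -- exchange the sums and factor the square
    have hx : ∀ x ∈ block L o n z, ∑ y ∈ block L o n z, ∑ m ∈ Finset.Ioc n M, β * (c * ((L : ℝ) ^ m) ^ (-((d : ℝ) + α))) *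
        ∑ a ∈ block L o m z, ∑ b ∈ block L o m z,
          (hierLaw J L o c α β).real {ξ | (openGraph (etaCfg (aboveFree L o (block L o m z)) ξ)).Reachable x a} *
          (hierLaw J L o c α β).real {ξ | (openGraph (etaCfg (aboveFree L o (block L o m z)) ξ)).Reachable y b} =
        ∑ m ∈ Finset.Ioc n M, ∑ y ∈ block L o n z, β * (c * ((L : ℝ) ^ m) ^ (-((d : ℝ) + α))) *
        ∑ a ∈ block L o m z, ∑ b ∈ block L o m z,
          (hierLaw J L o c α β).real {ξ | (openGraph (etaCfg (aboveFree L o (block L o m z)) ξ)).Reachable x a} *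
          (hierLaw J L o c α β).real {ξ | (openGraph (etaCfg (aboveFree L o (block L o m z)) ξ)).Reachable y b} :=
      fun x _ => Finset.sum_comm
    rw [Finset.sum_congr rfl hx, Finset.sum_comm]
    refine Finset.sum_congr rfl fun m _ => ?_
    rw [sq, Tblock]
    simp only [etaLaw_real_openConn_eq]
    rw [← sum_sum_sum_sum_mul]
    simp_rw [← Finset.mul_sum]

end Summed


end Literature.Probability.Percolation

end
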